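import Summits.KontsevichZagierPeriods.KontsevichZagierPeriods.Theses.ComplexOrientations
import Summits.KontsevichZagierPeriods.KontsevichZagierPeriods.Theorems.SymplecticScissorsPlanarTransport
import Summits.KontsevichZagierPeriods.KontsevichZagierPeriods.Theorems.ComplexOrientationsOrientationKernelSectorReductionNecessity

/-!
# Crux `TypeOneIdentities` (stmt-KontsevichZagierPeriods-11368): its logical position under the planar kernel

Helper file (`--supports` the crux) recording the route's KILL CRITERIA clause "PlanarAreas (stmt-4990)
proved ⇒ TypeOneIdentities follows" as theorems:

* `typeOneIdentities_of_boundedPlanarKernel` — if any two BOUNDED planar representations with integrand `1`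
  and equal area are congruent modulo the moves, then `TypeOneIdentities` holds: the crux's combination
  `Σ ηᵢ [sᵢ] − [e]` lies in the 1-period sector (oval interiors of a compact curve and the `π`-carrier disc
  are bounded — `isBounded_setOf_isBounded_connectedComponentIn_compl`, `isBounded_disc`, landed for the
  sibling crux `OrientationKernel`), its value vanishes by the hypothesis `Σ ηᵢ value(sᵢ) = value(e)`, and
  `sector_mem_relations_of_boundedPlanarKernel` (landed) puts every vanishing sector element in
  `KZ.relations`. The curve hypotheses (smooth, irreducible, dividing) and the unit signs are idle here.
* `typeOneIdentities_of_planarAreas` — `SymplecticScissors.PlanarAreas → TypeOneIdentities` (by name, via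
  `boundedPlanarKernel_of_planarAreas`).
* `typeOneIdentities_of_huberWustholzCurvePeriods` — **the crux modulo ONE cite-only published theorem**:
  `Literature.NumberTheory.Transcendental.HuberWustholzCurvePeriods` (Huber–Wüstholz 2022, Thm. 13.3 (2): all
  ℚ̄-linear relations among periods of curve type are induced by bilinearity and functoriality) implies
  `TypeOneIdentities`, through the LANDED `SymplecticScissors.PlanarTransport.planarAreas_of_huberWustholzCurvePeriods`
  (Theorems/SymplecticScissorsPlanarTransport.lean) and the glue above. CONDITIONAL RESULT: no `_holds` discharge of
  the Huber–Wüstholz fact exists in the tree; the item stays open until one does (or until the HW-free Rokhlin-anchor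
  line of `Cruxes/TypeOneIdentities/Lines/birth.lean` closes).

No definitions; pure bookkeeping over landed lemmas. References: M. Kontsevich, D. Zagier, *Periods* (2001),
§1.2; A. Huber, G. Wüstholz, *Transcendence and linear relations of 1-periods* (2022), Thm. 13.3 (2); route file
`Theses/ComplexOrientations.lean`, KILL CRITERIA ("PlanarAreas (stmt-4990) proved ⇒ TypeOneIdentities follows").
-/

noncomputable section

open Literature.NumberTheory.Transcendental
open Summit.KontsevichZagierPeriods.KontsevichZagierPeriods.Theses.ComplexOrientations (TypeOneIdentities)
open Summit.KontsevichZagierPeriods.KontsevichZagierPeriods.Theses.SymplecticScissors (PlanarAreas)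
open Summit.KontsevichZagierPeriods.ComplexOrientations.OrientationKernel

namespace Summit.KontsevichZagierPeriods.ComplexOrientations.TypeOneIdentities

/-- **The crux's combination lies in the 1-period sector.** For a real plane curve with compact real
locus, ovals `Oᵢ`, integrand-`1` representations `sᵢ` over their interiors and a `π`-carrier `e`, the
combination `Σ nᵢ • [sᵢ] − [e]` lies in the subgroup generated by the classes of bounded planar
integrand-`1` representations (hence in the 1-period sector `S`). [folklore] -/
theorem ovalCombination_mem_sector
    (p : MvPolynomial (Fin 2) ℚ) (hp : IsCompact {v : Fin 2 → ℝ | MvPolynomial.aeval v p = 0})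
    (k : ℕ) (O : Fin k → Set (Fin 2 → ℝ)) (s : Fin k → KZ.IntegralRep 2)
    (hO : ∀ i, ∃ v : Fin 2 → ℝ, MvPolynomial.aeval v p = 0 ∧
      O i = connectedComponentIn {u : Fin 2 → ℝ | MvPolynomial.aeval u p = 0} v)
    (hdom : ∀ i, (s i).domain =
      {v : Fin 2 → ℝ | v ∉ O i ∧ Bornology.IsBounded (connectedComponentIn (O i)ᶜ v)})
    (hint : ∀ i, ∀ v ∈ (s i).domain, (s i).integrand v = 1)
    (n : Fin k → ℤ) (β : ℝ) (e : KZ.IntegralRep 2)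
    (he : e.domain = {v : Fin 2 → ℝ | v 0 ^ 2 + v 1 ^ 2 < β}) (heint : ∀ v ∈ e.domain, e.integrand v = 1) :
    (∑ i, n i • KZ.of (s i)) - KZ.of e ∈ AddSubgroup.closure ({c : KZ.FormalRep | ∃ s :
      KZ.IntegralRep 0, c = KZ.of s} ∪ {c : KZ.FormalRep | ∃ s : KZ.IntegralRep 1, c = KZ.of s} ∪ {c
      : KZ.FormalRep | ∃ s : KZ.IntegralRep 2, Bornology.IsBounded s.domain ∧ (∀ v ∈ s.domain,
      s.integrand v = 1) ∧ c = KZ.of s}) := by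
  set S : AddSubgroup KZ.FormalRep := AddSubgroup.closure
    ({c : KZ.FormalRep | ∃ s : KZ.IntegralRep 0, c = KZ.of s} ∪
      {c : KZ.FormalRep | ∃ s : KZ.IntegralRep 1, c = KZ.of s} ∪
      {c : KZ.FormalRep | ∃ s : KZ.IntegralRep 2, Bornology.IsBounded s.domain ∧
        (∀ v ∈ s.domain, s.integrand v = 1) ∧ c = KZ.of s}) with hS_def
  have planar_mem : ∀ s : KZ.IntegralRep 2, Bornology.IsBounded s.domain →
      (∀ v ∈ s.domain, s.integrand v = 1) → KZ.of s ∈ S :=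
    fun s hb h1 => AddSubgroup.subset_closure (Or.inr ⟨s, hb, h1, rfl⟩)
  refine S.sub_mem (S.sum_mem fun i _ => S.zsmul_mem (planar_mem _ ?_ (hint i)) _)
    (planar_mem _ ?_ heint)
  · obtain ⟨v, -, hOi⟩ := hO i
    rw [hdom i]
    exact isBounded_setOf_isBounded_connectedComponentIn_compl hp (hOi ▸ connectedComponentIn_subset _ _)
  · rw [he]
    exact isBounded_disc β

/-- **The bounded planar kernel implies the crux `TypeOneIdentities`.** If any two bounded planar
integrand-`1` representations of equal area are congruent modulo the moves of the Kontsevich–Zagier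
calculus, then every true unit-sign oval-area identity of a dividing curve against a `π`-disc is a chain:
the combination lies in the 1-period sector (`ovalCombination_mem_sector`), its value is `0` by the
hypothesis `Σ ηᵢ value(sᵢ) = value(e)`, and vanishing sector elements are relations
(`sector_mem_relations_of_boundedPlanarKernel`). [Kontsevich–Zagier 2001, §1.2; folklore] -/
theorem typeOneIdentities_of_boundedPlanarKernel
    (h : ∀ A B : KZ.IntegralRep 2, Bornology.IsBounded A.domain → Bornology.IsBounded B.domain →
      (∀ v ∈ A.domain, A.integrand v = 1) → (∀ v ∈ B.domain, B.integrand v = 1) →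
      A.value = B.value → KZ.of A - KZ.of B ∈ KZ.relations) :
    TypeOneIdentities := by
  intro p hcpt _ _ _ k O s hO _ _ hdom hone η β e _ _ _ hed hei hval
  refine sector_mem_relations_of_boundedPlanarKernel h _
    (ovalCombination_mem_sector p hcpt k O s hO hdom hone η β e hed hei) ?_
  simp only [map_sub, map_sum, map_zsmul, KZ.eval_of, zsmul_eq_mul, hval, sub_self]

/-- **`PlanarAreas → TypeOneIdentities`** (the route's KILL CRITERIA clause, by name): the planar kernel
item stmt-KontsevichZagierPeriods-4990 of route `SymplecticScissors` gives the bounded planar kernel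
(`boundedPlanarKernel_of_planarAreas`), hence the crux. [folklore] -/
theorem typeOneIdentities_of_planarAreas (h : PlanarAreas) : TypeOneIdentities :=
  typeOneIdentities_of_boundedPlanarKernel (boundedPlanarKernel_of_planarAreas h)

/-- **`TypeOneIdentities` modulo Huber–Wüstholz (conditional result).** The cite-only named fact
`HuberWustholzCurvePeriods` (Huber–Wüstholz 2022, Thm. 13.3 (2), the period conjecture for periods of curve
type) implies the crux: it gives `PlanarAreas` (landed, `planarAreas_of_huberWustholzCurvePeriods`: every
ℚ̄-linear relation among real 1-periods is a chain of real semialgebraic moves, hence equal-area planar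
ℚ-regions are KZ-equivalent), and `PlanarAreas → TypeOneIdentities` is `typeOneIdentities_of_planarAreas`.
[cite: HuberWustholz2022, Thm. 13.3 (2)] -/
theorem typeOneIdentities_of_huberWustholzCurvePeriods (hHW : HuberWustholzCurvePeriods) : TypeOneIdentities :=
  typeOneIdentities_of_planarAreas
    (Summit.KontsevichZagierPeriods.SymplecticScissors.PlanarTransport.planarAreas_of_huberWustholzCurvePeriods hHW)

end Summit.KontsevichZagierPeriods.ComplexOrientations.TypeOneIdentities

end
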